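import Mathlib
import HarnessLib
import Summits.FinalStateConjecture.FinalStateConjecture.Theorems.DissipativeFinalMotionsFinalEraGenericTubeOrientation
import Summits.FinalStateConjecture.FinalStateConjecture.Theorems.StarvedNecksFutureOrientedOfSeamedStubPointwiseDeviation

/-!
# Route DissipativeFinalMotions — crux `FinalEraGeneric` (stmt-FinalStateConjecture-17642), line `registered`:
# tube orientation spreads to every `C⁰`-pinned slab (stub S3′ `stub_orientationSpreadsToSlabs`)

* `slabOrientation_chart` — one smooth chart `Ψ` from the sub-extremal Kerr exterior `{r > r₊}` into any spacetime: if
  `dΨ(V)` (`V = −g♯(dt*)`) is future-directed on the certified slab `{t* = τ, r ≤ 2ρ₀}` (`ρ₀ > r₊`) and the `C⁰` deviation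
  `‖Ψ^* g − g_{M,a}‖ ≤ 1/100` holds at the points of the slab `{t* = τ, r ≤ ρ}`, then `dΨ(V)` is future-directed on that slab:
  for `r(x) ≤ 2ρ₀` by hypothesis; otherwise the pin makes `dΨ(V)` timelike on the slab piece `{t* = τ, r₊ < r ≤ ρ}`, which is
  preconnected (spheroidal image of `(r₊, ρ] × S²`, `slabPiece_spheroidal`) and contains `x` and the axis pole
  `(τ, 0, 0, 2ρ₀)`, future-directed by hypothesis; one sign (`stub_oneSign`). No causality theory is needed here (the Cauchy
  argument lives in S3a).
* `stub_orientationSpreadsToSlabs` — the registered stub S3′ of the reshaped skeleton: for any tuple satisfying `IsFinalEra₂`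
  whose hole charts are future-oriented on the certified tubes, a hole `i`, a radius `ρ` and a chart time `τ > T` with
  `truncDeviationCk (B i) (Ψ i) 0 ρ τ ≤ 1/100`, the chart of hole `i` is future-oriented on `{t*ᵢ = τ, rᵢ ≤ ρ}`.

References: O'Neill 1983, Ch. 5, Lemma 5.26 ff. (p. 145); Dafermos–Rodnianski arXiv:0811.0354, §5.1; O'Neill 1995, Ch. 2, §2.1.
-/

noncomputable section

-- `<Problem> = <Summit>` doubles the namespace component (tree-wide convention)
set_option linter.dupNamespace false
-- instance search through nested operator types `E4 →L[ℝ] E4 →L[ℝ] ℝ`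
set_option maxSynthPendingDepth 3

open Set Filter Topology Function Metric
open scoped Manifold ContDiff ENNReal Topology
open Literature.Geometry.Lorentzian

namespace Summit.FinalStateConjecture.FinalStateConjecture.Theorems.DissipativeFinalMotions.FinalEraGeneric

open FutureOrientedOfSeamed.ClockDualityRays (stub_oneSign stub_coneTimelike stub_normSq_timeVector
  stub_pointwiseDeviation)

/-- **Orientation spreads from the certified slab to a pinned slab (one chart).** For sub-extremal `(M, a)`, `ρ₀ > r₊`, a
smooth chart `Ψ : {r > r₊} → 𝓢`, a chart time `τ` at which `dΨ(V)` is future-directed on `{t* = τ, r ≤ 2ρ₀}` and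
`‖(Ψ^* g − g_{M,a})(z)‖ ≤ 1/100` at every `z` with `z⁰ = τ`, `r(z) ≤ ρ`: `dΨ_x(V(x))` is future-directed at every `x` with
`x⁰ = τ`, `r(x) ≤ ρ`. O'Neill 1983, Ch. 5, Lemma 5.26 ff., p. 145; Dafermos–Rodnianski arXiv:0811.0354, §5.1. [folklore] -/
theorem slabOrientation_chart (𝓢 : Spacetime.{0} 4) {M a : ℝ} (hMa : Kerr.IsSubextremal M a) {ρ₀ : ℝ}
    (hρ₀ : Kerr.rPlus M a < ρ₀) (Ψ : (Kerr.background M a).domain → 𝓢.carrier)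
    (hΨ : ContMDiff 𝓘(ℝ, E4) (𝓡 4) ∞ Ψ) {τ ρ : ℝ}
    (htube : ∀ x ∈ (Kerr.background M a).truncTimeSlab (2 * ρ₀) τ,
      𝓢.timeOrientation.IsFutureDirected (mfderiv 𝓘(ℝ, E4) (𝓡 4) Ψ x (Kerr.timeVector M a x.1)))
    (hpin : ∀ z : (Kerr.background M a).domain, z.1 0 = τ → Kerr.radius a z.1 ≤ ρ →
      ‖𝓢.deviation (Kerr.background M a) Ψ z‖ ≤ 1 / 100)
    (x : (Kerr.background M a).domain) (hx : x ∈ (Kerr.background M a).truncTimeSlab ρ τ) :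
    𝓢.timeOrientation.IsFutureDirected (mfderiv 𝓘(ℝ, E4) (𝓡 4) Ψ x (Kerr.timeVector M a x.1)) := by
  rcases le_or_gt (Kerr.radius a x.1) (2 * ρ₀) with hle | hgt
  · exact htube x ⟨hx.1, hle⟩
  have hM : 0 < M := hMa.pos
  obtain ⟨hm0, -⟩ := rPlus_pos_and_M_le hMa
  set m := Kerr.rPlus M a with hm
  have hmR : m < 2 * ρ₀ := by linarith
  have hR0 : 0 < 2 * ρ₀ := hm0.trans hmR
  have hRρ : 2 * ρ₀ ≤ ρ := hgt.le.trans hx.2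
  -- membership in the exterior `{r > max r₊ 0}` = `{r > r₊}`
  have hmax : max (Kerr.rPlus M a) 0 = m := max_eq_left hm0.le
  have hmem_ext : ∀ z : E4, z ∈ ((Kerr.background M a).domain : Set E4) ↔ m < Kerr.radius a z :=
    fun z ↦ by
    show z ∈ Kerr.exterior M a ↔ _
    rw [Kerr.mem_exterior, hmax]
  have hrad_pos : ∀ z : (Kerr.background M a).domain, 0 < Kerr.radius a z.1 := fun z ↦
    hm0.trans ((hmem_ext z.1).1 z.2)
  -- `dΨ(V)` is timelike at the pinned points of the slab
  have htl : ∀ z : (Kerr.background M a).domain, z.1 0 = τ → Kerr.radius a z.1 ≤ ρ →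
      𝓢.metric.IsTimelike (mfderiv 𝓘(ℝ, E4) (𝓡 4) Ψ z (Kerr.timeVector M a z.1)) := by
    intro z hzτ hzρ
    refine stub_coneTimelike 𝓢 (Kerr.background M a) Ψ z _ one_pos ?_ ?_ ?_
    · show Kerr.bilin M a z.1 _ _ ≤ -1
      rw [Kerr.bilin_timeVector_timeVector (hrad_pos z)]
      linarith [Kerr.scalarH_nonneg hM.le a z.1]
    · rw [mul_one]
      exact stub_normSq_timeVector hM.le (hrad_pos z) (Kerr.scalarH_le_one hMa z.2)
    · exact (hpin z hzτ hzρ).trans (by norm_num)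
  -- the pole `p = (τ, 0, 0, 2ρ₀)`, in the certified slab, future-directed by hypothesis
  set pE : E4 := E4.ofTimeSpace τ (WithLp.toLp 2 ![0, 0, 2 * ρ₀] : E3) with hpE
  have hp_rad : Kerr.radius a pE = 2 * ρ₀ := radius_axisPole a τ hR0
  have hp0 : pE 0 = τ := E4.ofTimeSpace_apply_zero τ _
  have hp_mem : pE ∈ ((Kerr.background M a).domain : Set E4) := (hmem_ext pE).2 (hp_rad ▸ hmR)
  set p : (Kerr.background M a).domain := ⟨pE, hp_mem⟩ with hp
  have hfdp : 𝓢.timeOrientation.IsFutureDirected (mfderiv 𝓘(ℝ, E4) (𝓡 4) Ψ p (Kerr.timeVector M a pE)) :=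
    htube p ⟨hp0, hp_rad.le⟩
  -- one sign on the preconnected slab piece `{t* = τ, r₊ < r ≤ ρ}`
  obtain ⟨hSpre, hSmem, hScov⟩ := slabPiece_spheroidal a τ hm0.le ρ
  set Spc := (fun q : ℝ × E3 ↦ E4.ofTimeSpace τ (WithLp.toLp 2
      ![√(q.1 ^ 2 + a ^ 2) * q.2 0, √(q.1 ^ 2 + a ^ 2) * q.2 1, q.1 * q.2 2] : E3)) ''
      (Ioc m ρ ×ˢ sphere (0 : E3) 1) with hSpc
  have hSO : Spc ⊆ ((Kerr.background M a).domain : Set E4) := fun z hz ↦ (hmem_ext z).2 (hSmem z hz).2.1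
  have hVc : ContinuousOn (Kerr.timeVector M a) ((Kerr.background M a).domain : Set E4) := fun z hz ↦
    (Kerr.contDiffAt_timeVector M a (hm0.trans ((hmem_ext z).1 hz)) (n := 0)).continuousAt.continuousWithinAt
  have hc : ∀ z : (Kerr.background M a).domain, (z : E4) ∈ Spc →
      𝓢.metric.IsCausal (mfderiv 𝓘(ℝ, E4) (𝓡 4) Ψ z (Kerr.timeVector M a z)) := fun z hz ↦
    (htl z (hSmem z hz).1 (hSmem z hz).2.2).isCausal
  have hpS : (p : E4) ∈ Spc := hScov pE hp0 (hp_rad ▸ hmR) (hp_rad ▸ hRρ)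
  have hxS : (x : E4) ∈ Spc := hScov x.1 hx.1 ((hmem_ext x.1).1 x.2) hx.2
  exact stub_oneSign 𝓢 (Kerr.background M a) Ψ hΨ (Kerr.timeVector M a) hVc hSpre hSO hc p hpS hfdp x hxS

/-! ## The registered stub S3′ -/

/-- **S3′ — TUBE ORIENTATION SPREADS TO EVERY `C⁰`-PINNED SLAB** (registered stub `stub_orientationSpreadsToSlabs` of the
reshaped skeleton of line `registered`, crux `FinalEraGeneric`). For an admissible datum, a maximal development with complete `𝓘⁺`,
a tuple satisfying `IsFinalEra₂` whose hole charts are future-oriented on the certified tubes `{t*ᵢ = τ, rᵢ ≤ 2ρ₀}` (`τ > T`), a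
hole `i`, a radius `ρ` and a chart time `τ > T` with `truncDeviationCk (B i) (Ψ i) 0 ρ τ ≤ 1/100`: `dΨᵢ(V_{Mᵢ,aᵢ})` is
future-directed at every point of `{t*ᵢ = τ, rᵢ ≤ ρ}` — `slabOrientation_chart` for the chart of hole `i`, fed by clauses (B)
(`B i` is the Kerr background), (P) (sub-extremal), (H1) (smoothness), (ND) (`r₊ < ρ₀`), the tube hypothesis at `τ`, and the
pointwise extraction of the `C⁰` pin (`stub_pointwiseDeviation`). (Admissibility, maximality and complete `𝓘⁺` are not used.)
O'Neill 1983, Ch. 5, Lemma 5.26 ff.; Dafermos–Rodnianski arXiv:0811.0354, §5.1. [folklore] -/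
theorem stub_orientationSpreadsToSlabs : open scoped Manifold in ∀ (X : Type) [TopologicalSpace X] [ChartedSpace (EuclideanSpace ℝ (Fin 3)) X] [IsManifold (𝓡 3) ((⊤ : ℕ∞) : WithTop ℕ∞) X] [T2Space X] [SecondCountableTopology X] [ConnectedSpace X], ∀ D ∈ Literature.Geometry.Lorentzian.admissibleVacuumData X, ∀ 𝒟 : Literature.Geometry.Lorentzian.VacuumCauchyDevelopment D, 𝒟.IsMaximal → Summit.FinalStateConjecture.HasCompleteNullInfinity 𝒟.toCauchyDevelopment → ∀ (N : ℕ) (M a : Fin N → ℝ) (T δ V C₁ C₂ ρ₀ κ : ℝ) (ξ : Fin N → ℝ → EuclideanSpace ℝ (Fin 3)) (β : ℝ → ℝ) (U₀ : TopologicalSpace.Opens Literature.Geometry.Lorentzian.E4) (B₀ : Literature.Geometry.Lorentzian.ModelBackground) (B : Fin N → Literature.Geometry.Lorentzian.ModelBackground) (Ψ₀ : B₀.domain → 𝒟.carrier) (Ψ : (i : Fin N) → (B i).domain → 𝒟.carrier) (O : Set 𝒟.carrier), 𝒟.toCauchyDevelopment.IsFinalEra₂ N M a T δ V C₁ C₂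 ρ₀ κ ξ β U₀ B₀ B Ψ₀ Ψ O → (∀ i (τ : ℝ), T < τ → ∀ x ∈ (B i).truncTimeSlab (2 * ρ₀) τ, 𝒟.toSpacetime.timeOrientation.IsFutureDirected (mfderiv 𝓘(ℝ, Literature.Geometry.Lorentzian.E4) (𝓡 4) (Ψ i) x (Literature.Geometry.Lorentzian.Kerr.timeVector (M i) (a i) x.1))) → ∀ i (ρ τ : ℝ), T < τ → 𝒟.toSpacetime.truncDeviationCk (B i) (Ψ i) 0 ρ τ ≤ ENNReal.ofReal (1 / 100) → ∀ x ∈ (B i).truncTimeSlab ρ τ, 𝒟.toSpacetime.timeOrientation.IsFutureDirected (mfderiv 𝓘(ℝ, Literature.Geometry.Lorentzian.E4) (𝓡 4) (Ψ i) x (Literature.Geometry.Lorentzian.Kerr.timeVector (M i) (a i) x.1)) := by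
  intro X _ _ _ _ _ _ D _ 𝒟 _ _ N M a T δ V C₁ C₂ ρ₀ κ ξ β U₀ B₀ B Ψ₀ Ψ O hera htube i ρ τ hτ hE x hx
  obtain ⟨-, -, h₃, h₄, -, -, -, -, -, -, -, -, -, -, -, -, -, -, -, -, h₂₁, -, -, -, -, -, -, -,
    -, -, h₃₁⟩ := hera
  subst h₃
  have hpin : ∀ z : (Kerr.background (M i) (a i)).domain, z.1 0 = τ → Kerr.radius (a i) z.1 ≤ ρ →
      ‖𝒟.toSpacetime.deviation (Kerr.background (M i) (a i)) (Ψ i) z‖ ≤ 1 / 100 := fun z hzτ hzρ ↦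
    stub_pointwiseDeviation 𝒟.toSpacetime (Kerr.background (M i) (a i)) (Ψ i) (by norm_num) hE z ⟨hzτ, hzρ⟩
  exact slabOrientation_chart 𝒟.toSpacetime (h₄ i) (h₃₁ i) (Ψ i) (h₂₁ i).contMDiff (htube i τ hτ) hpin x hx

end Summit.FinalStateConjecture.FinalStateConjecture.Theorems.DissipativeFinalMotions.FinalEraGeneric

end
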